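import Summits.Ventures.CertifiedManyBodySolver.Downfold.EmeryBoxesSLCOThermalCapWord
import Summits.Ventures.CertifiedManyBodySolver.Downfold.EmeryThermalCapRetiltBoxp1
import HarnessLib

/-!
# RE-TILTED `CuO₄` CORNER CERTIFICATES on `emeryBoxSLCOClass`: the four kgp1x5 sector tables read SECTOR-WISE at the cap word's common level εp = -59/5
# tighten hubbard-downfold-mod-4's `T > 0` cap word `49.9260·β + 6 log 2 → 48.3066·β + 6 log 2` and the two-sided window width `5.258·β → 3.639·β` (+ 6 log 2)

Venture CertifiedManyBodySolver, cell `pub/hubbard-downfold` (S1 = ROUTER) × crew hubbard-fast S2 (ii) × (iv) «T > 0 × multi-band» (D-0096 (ii)); seat hubbard-box-p1 g21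
(row «Lipschitz in (U, μ) of certified objects; box ⊂ ∪ cells ⇒ word»), by value for the word owner hubbard-downfold-mod-4 (ask «RE-TILT law», hubbard-fast INBOX
2026-08-28T18:54:56Z (a)). Namespace `Summit.Ventures.CertifiedManyBodySolver.Downfold`. Same construction as `EmeryThermalCapRetiltBoxp1` (La₂CuO₄ #18).

INPUTS BY NAME: `EmeryBoxesSLCOThermalCapWord` (cap word `emeryBoxSLCOClass_pressureCap_m59o5` at εp = -59/5 by MONOTONE level transfer of the four corner certificates
`slcoClassFloor_hq_lowerCorner` — tilts `μ = (-59/5, -12, -12, -61/5)`, `q₀ = (-381/4, -244038047/2500000, -60925293/625000, -998519063/10000000)` — and the same-level family floor `emeryBoxSLCOClass_pressureFloorFam_m59o5`,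
`C = (-178670811/1000000, -88889929/500000)`); `EmeryBoxesSLCOClassFloorWord` (table identities `slcoClassFloor_tau/ups/nu i`); box-p2's sector tables `kgp1x5_<c>_table` / `_sigma`
(SLCOx_c0_ll_mum118o10, SLCOx_c1_hl_mum120o10, SLCOx_c2_lh_mum120o10, SLCOx_c3_hh_mum122o10); the Literature law `EmeryThreeBandCuO4CertificateRetilt` (`posSemidef_cuO4_uniform_retilt_of_sectorFloors`: at M = 2 the shift of sector `k` under
`θ ↦ θ + c·ε` is `≥ max(c·k + min(0, 2c), 2c·k − 4·max(0, 2c))`).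

RE-TILTED CONSTANTS at εp = -59/5 (exact; binding sector in brackets): q₀′ = (-381/4 [k = 9, c = 0], -239871797/2500000 [k = 8, c = 1/5], -1533651/16000 [k = 8, c = 1/5], -966131563/10000000 [k = 8, c = 2/5]);
slopes `−q₀′/2 = (47.6250, 47.9744, 47.9266, 48.3066)` ⇒ **box cap constant `966131563/20000000 = 48.3065781`** (corner 3 binds) versus `998519063/20000000 = 49.9259531` of record;
linear window `44.6677·β ≤ P_cell ≤ 48.3066·β + 6 log 2` (width `3.639·β + 6 log 2`, was `5.258·β + 6 log 2`).

Everything PROVED (0 sorry; `norm_num` on the 11-row tables); no definition, no new certificate, no kit. HONEST FRAMING: CERTIFIED inequalities on a SCREENING-GRADE object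
(box ends [float]/DFT with locators in the router's BOXES files); the cap keeps the full entropy `6 log 2` per CuO₂; grand-canonical statements at a stated level; no phase
word; no router number moves. WHAT-THIS-IS-NOT: a number of record — bookkeeping that lets one kernel table per corner serve every reference level.
-/

noncomputable section

namespace Summit.Ventures.CertifiedManyBodySolver.Downfold

open NonemptyInterval Matrix Finset Literature.Probability.LatticeModels
open Literature.MathematicalPhysics.QuantumLattice Literature.Computation.Certificates
open Summit.Ventures.CertifiedManyBodySolver.Certificates OccupationCode ClusterLowerBound
open scoped BigOperators ComplexOrder

/-! ## §1 The four sector tables in dictionary form -/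

/-- **Sector table, corner 0** (tilt `μ = -59/5`): box-p2's `kgp1x5_SLCOx_c0_ll_mum118o10_table` in dictionary form, `θ = emeryLine cuprateSigns (slcoClassCorner 0) + (-59/5)·levelDir`.
[cite: KullEtAl2024, §5.3] -/
theorem slcoClassFloor_table0 : ∀ k ≤ 10, ((kgp1x5_SLCOx_c0_ll_mum118o10_sigma k : ℚ) : ℝ) ≤
    groundEnergy (hubbardOpenBoxGP 1 5 (plusTau (emeryLine cuprateSigns (slcoClassCorner 0) + (-59/5 : ℝ) • levelDir) 2)
      (plusUps (emeryLine cuprateSigns (slcoClassCorner 0) + (-59/5 : ℝ) • levelDir) 2)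
      (plusNu (emeryLine cuprateSigns (slcoClassCorner 0) + (-59/5 : ℝ) • levelDir) 2)) k := by
  intro k hk
  have h := kgp1x5_SLCOx_c0_ll_mum118o10_table k hk
  rw [slcoClassFloor_tau0, slcoClassFloor_ups0, slcoClassFloor_nu0] at h
  exact h

/-- **Sector table, corner 1** (tilt `μ = -12`): box-p2's `kgp1x5_SLCOx_c1_hl_mum120o10_table` in dictionary form, `θ = emeryLine cuprateSigns (slcoClassCorner 1) + (-12)·levelDir`.
[cite: KullEtAl2024, §5.3] -/
theorem slcoClassFloor_table1 : ∀ k ≤ 10, ((kgp1x5_SLCOx_c1_hl_mum120o10_sigma k : ℚ) : ℝ) ≤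
    groundEnergy (hubbardOpenBoxGP 1 5 (plusTau (emeryLine cuprateSigns (slcoClassCorner 1) + (-12 : ℝ) • levelDir) 2)
      (plusUps (emeryLine cuprateSigns (slcoClassCorner 1) + (-12 : ℝ) • levelDir) 2)
      (plusNu (emeryLine cuprateSigns (slcoClassCorner 1) + (-12 : ℝ) • levelDir) 2)) k := by
  intro k hk
  have h := kgp1x5_SLCOx_c1_hl_mum120o10_table k hk
  rw [slcoClassFloor_tau1, slcoClassFloor_ups1, slcoClassFloor_nu1] at h
  exact h

/-- **Sector table, corner 2** (tilt `μ = -12`): box-p2's `kgp1x5_SLCOx_c2_lh_mum120o10_table` in dictionary form, `θ = emeryLine cuprateSigns (slcoClassCorner 2) + (-12)·levelDir`.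
[cite: KullEtAl2024, §5.3] -/
theorem slcoClassFloor_table2 : ∀ k ≤ 10, ((kgp1x5_SLCOx_c2_lh_mum120o10_sigma k : ℚ) : ℝ) ≤
    groundEnergy (hubbardOpenBoxGP 1 5 (plusTau (emeryLine cuprateSigns (slcoClassCorner 2) + (-12 : ℝ) • levelDir) 2)
      (plusUps (emeryLine cuprateSigns (slcoClassCorner 2) + (-12 : ℝ) • levelDir) 2)
      (plusNu (emeryLine cuprateSigns (slcoClassCorner 2) + (-12 : ℝ) • levelDir) 2)) k := by
  intro k hk
  have h := kgp1x5_SLCOx_c2_lh_mum120o10_table k hk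
  rw [slcoClassFloor_tau2, slcoClassFloor_ups2, slcoClassFloor_nu2] at h
  exact h

/-- **Sector table, corner 3** (tilt `μ = -61/5`): box-p2's `kgp1x5_SLCOx_c3_hh_mum122o10_table` in dictionary form, `θ = emeryLine cuprateSigns (slcoClassCorner 3) + (-61/5)·levelDir`.
[cite: KullEtAl2024, §5.3] -/
theorem slcoClassFloor_table3 : ∀ k ≤ 10, ((kgp1x5_SLCOx_c3_hh_mum122o10_sigma k : ℚ) : ℝ) ≤
    groundEnergy (hubbardOpenBoxGP 1 5 (plusTau (emeryLine cuprateSigns (slcoClassCorner 3) + (-61/5 : ℝ) • levelDir) 2)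
      (plusUps (emeryLine cuprateSigns (slcoClassCorner 3) + (-61/5 : ℝ) • levelDir) 2)
      (plusNu (emeryLine cuprateSigns (slcoClassCorner 3) + (-61/5 : ℝ) • levelDir) 2)) k := by
  intro k hk
  have h := kgp1x5_SLCOx_c3_hh_mum122o10_table k hk
  rw [slcoClassFloor_tau3, slcoClassFloor_ups3, slcoClassFloor_nu3] at h
  exact h

/-! ## §2 Level εp = -59/5: re-tilted certificates, cap word, two-sided window -/

/-- **Re-tilted certificate, corner 0 at level -59/5** (from tilt `-59/5`, `c = 0`; binding sector `k = 9`):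
`H^(w_2)_(W₅)[emeryInteraction (θ_0 + (-59/5)·levelDir)] + 0 − (-381/4)·1 ⪰ 0` (slope `−q₀′/2 = 47.6250000`). [cite: KullEtAl2024, §5.3] [cite: ValentiStolzeHirschfeld1991, §II] -/
theorem slcoClassRetilt_hq_m59o5_c0 :
    ((⟨fun X => (uniformPeriodicWeight liebPeriods emeryCuO4Window 2 X : ℂ) •
        (emeryInteraction (emeryLine cuprateSigns (slcoClassCorner 0) + ((-59/5 : ℚ) : ℝ) • levelDir)).Φ X⟩ : FermionInteraction 2).localHamiltonian
        emeryCuO4Window + (0 : FermionOp emeryCuO4Window) - ((-381/4 : ℝ) : ℂ) • (1 : FermionOp emeryCuO4Window)).PosSemidef := by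
  have h := posSemidef_cuO4_uniform_retilt_of_sectorFloors (emeryLine cuprateSigns (slcoClassCorner 0) + (-59/5 : ℝ) • levelDir) 2 (0 : ℝ)
    (σ := fun k => ((kgp1x5_SLCOx_c0_ll_mum118o10_sigma k : ℚ) : ℝ)) slcoClassFloor_table0 (q := (-381/4 : ℝ)) (fun k hk => by
      interval_cases k <;> norm_num [kgp1x5_SLCOx_c0_ll_mum118o10_sigma, max_def, min_def])
  rw [tilt_add_retilt, show (-59/5 : ℝ) + 0 = ((-59/5 : ℚ) : ℝ) by norm_num] at h
  exact h

/-- **Re-tilted certificate, corner 1 at level -59/5** (from tilt `-12`, `c = 1/5`; binding sector `k = 8`):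
`H^(w_2)_(W₅)[emeryInteraction (θ_1 + (-59/5)·levelDir)] + 0 − (-239871797/2500000)·1 ⪰ 0` (slope `−q₀′/2 = 47.9743594`). [cite: KullEtAl2024, §5.3] [cite: ValentiStolzeHirschfeld1991, §II] -/
theorem slcoClassRetilt_hq_m59o5_c1 :
    ((⟨fun X => (uniformPeriodicWeight liebPeriods emeryCuO4Window 2 X : ℂ) •
        (emeryInteraction (emeryLine cuprateSigns (slcoClassCorner 1) + ((-59/5 : ℚ) : ℝ) • levelDir)).Φ X⟩ : FermionInteraction 2).localHamiltonian
        emeryCuO4Window + (0 : FermionOp emeryCuO4Window) - ((-239871797/2500000 : ℝ) : ℂ) • (1 : FermionOp emeryCuO4Window)).PosSemidef := by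
  have h := posSemidef_cuO4_uniform_retilt_of_sectorFloors (emeryLine cuprateSigns (slcoClassCorner 1) + (-12 : ℝ) • levelDir) 2 (1/5 : ℝ)
    (σ := fun k => ((kgp1x5_SLCOx_c1_hl_mum120o10_sigma k : ℚ) : ℝ)) slcoClassFloor_table1 (q := (-239871797/2500000 : ℝ)) (fun k hk => by
      interval_cases k <;> norm_num [kgp1x5_SLCOx_c1_hl_mum120o10_sigma, max_def, min_def])
  rw [tilt_add_retilt, show (-12 : ℝ) + 1/5 = ((-59/5 : ℚ) : ℝ) by norm_num] at h
  exact h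

/-- **Re-tilted certificate, corner 2 at level -59/5** (from tilt `-12`, `c = 1/5`; binding sector `k = 8`):
`H^(w_2)_(W₅)[emeryInteraction (θ_2 + (-59/5)·levelDir)] + 0 − (-1533651/16000)·1 ⪰ 0` (slope `−q₀′/2 = 47.9265938`). [cite: KullEtAl2024, §5.3] [cite: ValentiStolzeHirschfeld1991, §II] -/
theorem slcoClassRetilt_hq_m59o5_c2 :
    ((⟨fun X => (uniformPeriodicWeight liebPeriods emeryCuO4Window 2 X : ℂ) •
        (emeryInteraction (emeryLine cuprateSigns (slcoClassCorner 2) + ((-59/5 : ℚ) : ℝ) • levelDir)).Φ X⟩ : FermionInteraction 2).localHamiltonian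
        emeryCuO4Window + (0 : FermionOp emeryCuO4Window) - ((-1533651/16000 : ℝ) : ℂ) • (1 : FermionOp emeryCuO4Window)).PosSemidef := by
  have h := posSemidef_cuO4_uniform_retilt_of_sectorFloors (emeryLine cuprateSigns (slcoClassCorner 2) + (-12 : ℝ) • levelDir) 2 (1/5 : ℝ)
    (σ := fun k => ((kgp1x5_SLCOx_c2_lh_mum120o10_sigma k : ℚ) : ℝ)) slcoClassFloor_table2 (q := (-1533651/16000 : ℝ)) (fun k hk => by
      interval_cases k <;> norm_num [kgp1x5_SLCOx_c2_lh_mum120o10_sigma, max_def, min_def])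
  rw [tilt_add_retilt, show (-12 : ℝ) + 1/5 = ((-59/5 : ℚ) : ℝ) by norm_num] at h
  exact h

/-- **Re-tilted certificate, corner 3 at level -59/5** (from tilt `-61/5`, `c = 2/5`; binding sector `k = 8`):
`H^(w_2)_(W₅)[emeryInteraction (θ_3 + (-59/5)·levelDir)] + 0 − (-966131563/10000000)·1 ⪰ 0` (slope `−q₀′/2 = 48.3065781`). [cite: KullEtAl2024, §5.3] [cite: ValentiStolzeHirschfeld1991, §II] -/
theorem slcoClassRetilt_hq_m59o5_c3 :
    ((⟨fun X => (uniformPeriodicWeight liebPeriods emeryCuO4Window 2 X : ℂ) •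
        (emeryInteraction (emeryLine cuprateSigns (slcoClassCorner 3) + ((-59/5 : ℚ) : ℝ) • levelDir)).Φ X⟩ : FermionInteraction 2).localHamiltonian
        emeryCuO4Window + (0 : FermionOp emeryCuO4Window) - ((-966131563/10000000 : ℝ) : ℂ) • (1 : FermionOp emeryCuO4Window)).PosSemidef := by
  have h := posSemidef_cuO4_uniform_retilt_of_sectorFloors (emeryLine cuprateSigns (slcoClassCorner 3) + (-61/5 : ℝ) • levelDir) 2 (2/5 : ℝ)
    (σ := fun k => ((kgp1x5_SLCOx_c3_hh_mum122o10_sigma k : ℚ) : ℝ)) slcoClassFloor_table3 (q := (-966131563/10000000 : ℝ)) (fun k hk => by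
      interval_cases k <;> norm_num [kgp1x5_SLCOx_c3_hh_mum122o10_sigma, max_def, min_def])
  rw [tilt_add_retilt, show (-61/5 : ℝ) + 2/5 = ((-59/5 : ℚ) : ℝ) by norm_num] at h
  exact h

/-- Every re-tilted corner slope at level -59/5 is at most `966131563/20000000 = 48.3065781` (corner 3 binds). [folklore] -/
theorem slcoClassRetilt_c_le_m59o5 (i : Fin 4) :
    -((![-381/4, -239871797/2500000, -1533651/16000, -966131563/10000000] : Fin 4 → ℝ) i) / 2 ≤ (966131563/20000000 : ℝ) := by
  fin_cases i <;> simp <;> norm_num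

/-- **THE RE-TILTED CAP WORD at level εp = -59/5** (hypothesis-free, every β ≥ 0, every point of `emeryBoxSLCOClass`): `P_cell ≤ 6 log 2 + β·966131563/20000000`
(`48.3065781·β + 4.1589`) — versus `998519063/20000000 = 49.9259531` by monotone transfer (`emeryBoxSLCOClass_pressureCap_m59o5`).
[cite: Israel1979, Thm. I.2.4] [cite: ValentiStolzeHirschfeld1991, §II] -/
theorem emeryBoxSLCOClass_pressureCap_m59o5_retilt {β : ℝ} (hβ : 0 ≤ β) :
    HoldsOn (fun p : EmeryCoord → ℝ =>
      emeryCellPressure β (emeryLine cuprateSigns (emeryLineCoords (((-59/5 : ℚ)) : ℝ) p)) ≤ 6 * Real.log 2 + β * (966131563/20000000 : ℝ)) emeryBoxSLCOClass :=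
  holdsOn_emeryCellPressureCap_of_tiltedCuO4Certificates (E := emeryBoxSLCOClass) (eA := slcoClassEmery_tpd) (eB := slcoClassEmery_tpp) (eD := slcoClassEmery_Delta) (eUd := slcoClassEmery_Udd) (eUp := slcoClassEmery_Upp) rfl rfl rfl rfl rfl cuprateSigns hβ (M := 2) two_pos
    (fun _ => 0) (fun _ ω' _ => re_expect_zero_cuO4 ω') (fun _ => (((-59/5 : ℚ)) : ℝ))
    (![-381/4, -239871797/2500000, -1533651/16000, -966131563/10000000] : Fin 4 → ℝ)
    (fun i => by
      rw [slcoClass_lowerCorner]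
      fin_cases i
      · simpa using slcoClassRetilt_hq_m59o5_c0
      · simpa using slcoClassRetilt_hq_m59o5_c1
      · simpa using slcoClassRetilt_hq_m59o5_c2
      · simpa using slcoClassRetilt_hq_m59o5_c3)
    (fun _ => le_rfl) (fun i => by have h := slcoClassRetilt_c_le_m59o5 i; simpa [div_eq_mul_inv] using h)

/-- **TWO-SIDED `T > 0` WINDOW at level εp = -59/5** on `emeryBoxSLCOClass`, EVERY β ≥ 0, EVERY point: the family floor `emeryBoxSLCOClass_pressureFloorFam_m59o5` below, the re-tilted cap
above — both hypothesis-free. [cite: Israel1979, Thm. I.2.4] [cite: Ruelle1969, §2.5–2.6] -/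
theorem emeryBoxSLCOClass_pressureWindow_m59o5_retilt {β : ℝ} (hβ : 0 ≤ β) :
    HoldsOn (fun p : EmeryCoord → ℝ =>
      Real.log (Real.exp (-(β * (-178670811/1000000 : ℝ))) + Real.exp (-(β * (-88889929/500000 : ℝ)))) / 4 ≤
        emeryCellPressure β (emeryLine cuprateSigns (emeryLineCoords (((-59/5 : ℚ)) : ℝ) p)) ∧
      emeryCellPressure β (emeryLine cuprateSigns (emeryLineCoords (((-59/5 : ℚ)) : ℝ) p)) ≤ 6 * Real.log 2 + β * (966131563/20000000 : ℝ)) emeryBoxSLCOClass :=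
  fun p hp => ⟨emeryBoxSLCOClass_pressureFloorFam_m59o5 hβ p hp, emeryBoxSLCOClass_pressureCap_m59o5_retilt hβ p hp⟩

/-- **Linear reading** (best floor sector only): `β·178670811/4000000 ≤ P_cell ≤ 6 log 2 + β·966131563/20000000` (`44.6677·β ≤ P_cell ≤ 48.3066·β + 4.1589`;
width `3.6389·β + 6 log 2` per CuO₂, was `5.2583·β + 6 log 2`) on the whole box, every β ≥ 0. [cite: Israel1979, Thm. I.2.4] -/
theorem emeryBoxSLCOClass_pressureWindow_m59o5_retilt_linear {β : ℝ} (hβ : 0 ≤ β) :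
    HoldsOn (fun p : EmeryCoord → ℝ =>
      β * (178670811/4000000 : ℝ) ≤ emeryCellPressure β (emeryLine cuprateSigns (emeryLineCoords (((-59/5 : ℚ)) : ℝ) p)) ∧
      emeryCellPressure β (emeryLine cuprateSigns (emeryLineCoords (((-59/5 : ℚ)) : ℝ) p)) ≤ 6 * Real.log 2 + β * (966131563/20000000 : ℝ)) emeryBoxSLCOClass := by
  intro p hp
  refine ⟨le_trans ?_ (emeryBoxSLCOClass_pressureFloorFam_m59o5 hβ p hp), emeryBoxSLCOClass_pressureCap_m59o5_retilt hβ p hp⟩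
  have hk : β * (178670811/4000000 : ℝ) = Real.log (Real.exp (-(β * (-178670811/1000000 : ℝ)))) / 4 := by
    rw [Real.log_exp]; ring
  rw [hk]
  refine div_le_div_of_nonneg_right (Real.log_le_log (by positivity) ?_) (by norm_num)
  have h0 := Real.exp_pos (-(β * (-88889929/500000 : ℝ)))
  linarith

/-- **Grand-potential reading at level -59/5** (chemical potential `59/5` eV): for every `T > 0` and every point of the box,
`Ω/CuO₂ = −P_cell/β ≥ −966131563/20000000 − 6 log 2/β`. [cite: Israel1979, Thm. I.2.4] -/
theorem emeryBoxSLCOClass_grandPotential_ge_m59o5_retilt {β : ℝ} (hβ : 0 < β) :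
    HoldsOn (fun p : EmeryCoord → ℝ =>
      -(966131563/20000000 : ℝ) - 6 * Real.log 2 / β ≤ -emeryCellPressure β (emeryLine cuprateSigns (emeryLineCoords (((-59/5 : ℚ)) : ℝ) p)) / β) emeryBoxSLCOClass :=
  holdsOn_grandPotential_ge_of_pressureCap cuprateSigns hβ _ (emeryBoxSLCOClass_pressureCap_m59o5_retilt hβ.le)

end Summit.Ventures.CertifiedManyBodySolver.Downfold

end
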